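import Summits.CriticalPhenomena.Ising3DConformalLimit.Theses.FKParityRobustness
import Summits.CriticalPhenomena.Ising3DConformalLimit.Theorems.FKParityRobustnessDefs
import Summits.CriticalPhenomena.Ising3DConformalLimit.Theorems.FKParityRobustnessStrandShadowComposition
import Summits.CriticalPhenomena.Ising3DConformalLimit.Theorems.FKParityRobustnessStrandShadowPairSplit
import Summits.CriticalPhenomena.Ising3DConformalLimit.Theorems.FKParityRobustnessStrandShadowReplicaIdentities
import Summits.CriticalPhenomena.Ising3DConformalLimit.Theorems.StrandShadow.Negative.FreeCorrJunk
import Literature.Probability.LatticeModels.GKSInequalities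
import HarnessLib

/-!
# Line `replica-sponge-shadow` for the crux `StrandShadow` (stmt-CriticalPhenomena-14626)
# — crux-plan skeleton (planner), the CO-PIVOTALITY-FLUX cut below C⁺

`StrandShadow_proof : StrandShadow := StrandShadow_of stub_spongeFKG stub_heatBath
  stub_windowFlux stub_junkMargin stub_threeClean stub_symmetry`, sorries ONLY in the six `stub_*`
theorems — of which `stub_threeClean` and `stub_symmetry` are ALREADY PROVED in tree (p86528,
p87103; kept as stubs only because the hub holds no olean for those two modules, see below).

Card `Cruxes/StrandShadow/Ideas/replica-sponge-shadow.md` (ideator 2), triage `TRIAGE-r1-1.md`,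
`TRIAGE-r1-2.md` (both pass), Disproof `Cruxes/StrandShadow/Disproof.lean` (cdisprove c1: no
`_false_without_`, JUNK + COSTUME), lead's transfer line `Lines/Sketch.lean` (stubs pairSplit,
threeClean, symmetry, replicaIdentities LANDED under `Theorems/…StrandShadowSketch`; `stub_pairSplit`
(p91114) and `stub_replicaIdentities` (p94037) are IMPORTED and used as theorems; `stub_threeClean`,
`stub_symmetry` are restated verbatim as stubs because `…StrandShadowThreeClean` / `…Symmetry` have
no hub olean yet — accepted inside the 2026-08-16 farm-outage window — and any file importing them
is refused `remote:stale:unbuilt`).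

THE CUT.  The lead's line stops at C⁺ = `SpongeCovarianceGain` (`E_𝒜[XY] ≤ (1 − c)E_𝒜[X]E_𝒜[Y]`
on the agreement sponge `𝒜` of two critical replicas, law `∝ Z_{2β}(G[A])·Z_{2β}(G[Aᶜ])`, blue
`X(A) = 1[a₀,a₁ ∈ A]⟨σ₀σ₁⟩^free_{A,2β}` ↑, red `Y(A) = 1[a₂,a₃ ∉ A]⟨σ₂σ₃⟩^free_{Aᶜ,2β}` ↓), which
is INT in sponge dress (`gain_iff_int`, p87867).  This line opens C⁺ along the card's lever (a):
run the random-scan HEAT-BATH chain `K` of the sponge law and expand the covariance in time,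
`E[XY] − E[X]E[Y] = Σ_{k ≥ 0} (E[X·K^kY] − E[X·K^{k+1}Y])`, every bracket `≤ 0`
(X increasing, `K^kY` decreasing, `K` attractive, sponge FKG).  Hence ANY time window is a
rigorous one-sided bound, and C⁺ follows from

* `stub_spongeFKG` (finite graph, `β ≥ 0`; provable, M–L): the sponge law is FKG —
  `E_𝒜[f g] ≤ E_𝒜[f]·E_𝒜[g]` for `f` increasing, `g` decreasing (lattice condition
  `Zs(A∪B)Zs(A∩B) ≥ Zs(A)Zs(B)` from `Z(G[A∪v])/Z(G[A]) = ⟨2cosh 2βS_v⟩_{G[A]}` ↑ in `A` by the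
  even cosh-expansion + GKS I/II; then Ahlswede–Daykin / `four_functions_theorem`, Mathlib `fkg`);
* `stub_heatBath` (finite graph, `β ≥ 0`; provable, M): the random-scan heat-bath kernel
  `K g(A) = |V|⁻¹ Σ_v [p_v(A) g(A ∪ v) + (1 − p_v(A)) g(A ∖ v)]`, `p_v(A) = Zs(A∪v)/(Zs(A∪v)+Zs(A∖v))`,
  is STATIONARY for the sponge law (`E[K^n g] = E[g]`, detailed balance) and ATTRACTIVE
  (`K^n g` decreasing whenever `g` is: `p_v` is increasing in `A` — Holley's local form of the
  lattice condition);
* `stub_windowFlux` (ℤ³, `β_c`, tetrahedra `l·tetra ⊂ Λ_N`; THE BET, d = 3 content): a FIXED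
  number `T` of heat-bath sweeps releases a uniform fraction of the blue/red anticorrelation,
  `E[X·K^{T|Λ_N|}Y] − E[X·Y] ≥ c·E[X]·E[Y]` — the co-pivotality flux of CONTESTED sites
  (blue-pivotal for `a₀a₁` and one colour flip away from a red `a₂a₃`-connection) integrated over
  an `O(1)` time window is `≍ G₀₁G₂₃` (card (a); triage r1-1 sharpening: a mixed-pivotal
  abundance statement, NOT the static lost-set count).  Strictly STRONGER than C⁺ (fast release),
  hence not a costume; false for `d ≥ 5` and for `β < β_c` as it must be;
* `stub_junkMargin` (ℤ³, `β_c`; shared verbatim with line `Sketch`): the junk term by which the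
  FORMAL crux exceeds the intended `C′ = StrandShadowClean` (Disproof §1–2, `lhs_decomposition`,
  `strandShadow_imp_clean`) is a proper fraction `κ < 1` of the clean deficit — provable for
  `l ≥ l₀` from INT + sourced switching + infrared decay, numerics-only at small `l` (MC j013016:
  `0.05` vs `0.3` at `l = 1`).

Composition (proved here, no sorry): `gain_of_window` (three lines of order-algebra: FKG applied
to `X` ↑ and `K^nY` ↓, stationarity, the window) gives C⁺ at every `(N, a)` with the SAME `c`;
then the landed finite-graph core `StrandShadowSketch.shadow_core` (p91130) with the imported
`stub_pairSplit` (p91114), `stub_replicaIdentities` (p94037), the restated `stub_threeClean` (p86528),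
`stub_symmetry` (p87103) and the junk margin gives the crux with `c′ = (1 − κ)(2/3)c`.  Inputs
elaborated in OTHER files carry other instance paths (`Decidable`/`Fintype` choices differ between a
full-`Mathlib` context and the lean Theorems files): they are bridged into `shadow_core` with
`convert … using 12` (direct application times out at `whnf`), as the crux body itself is.
Monotonicity of `X`/`Y` in the sponge is Griffiths' volume monotonicity
(`isingCorr_free_le_of_subset`) + GKS I, proved below (`blue_monotone`, `red_antitone`).
-/

noncomputable section

open Finset SimpleGraph
open Literature.Probability.LatticeModels
open Summit.CriticalPhenomena.Ising3DConformalLimit.Theses.FKParityRobustness (StrandShadow)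
open Summit.CriticalPhenomena.Ising3DConformalLimit.Theorems

namespace Summit.CriticalPhenomena.Ising3DConformalLimit.Cruxes.StrandShadow.ReplicaSpongeShadow

open scoped Classical

/-! ## The registered stubs -/

/-- **stub_spongeFKG** — the agreement-sponge law `μ(A) ∝ Zs(A) = Z^free_A(2β)·Z^free_{Aᶜ}(2β)`
of two independent zero-field replicas on a finite graph is an FKG measure on the Boolean lattice
`(Finset V, ⊆)`: for `f` increasing and `g` decreasing, `E_𝒜[f·g] ≤ E_𝒜[f]·E_𝒜[g]` (`β ≥ 0`).
Route: lattice condition `Zs(A ∪ B)·Zs(A ∩ B) ≥ Zs(A)·Zs(B)` (Holley's local form: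
`Z(G[B ∪ v])/Z(G[B]) = 2⟨cosh(2β·S_v^B)⟩^free_{G[B]}` is increasing in `B` by the even
cosh-expansion and GKS I/II; the `Aᶜ`-factor is the same statement for the complement), then
the four-functions theorem (Mathlib `four_functions_theorem` / `fkg`, shifted to signed `f, g`).
[FortuinKasteleynGinibre1971; Holley1974; Lebowitz1974; card §Lever, triage r1-1 "0 violations /
65 792 pairs"] -/
theorem stub_spongeFKG :
    ∀ (V : Type) [Fintype V] [DecidableEq V] (G : SimpleGraph V) [DecidableRel G.Adj] (β : ℝ),
      0 ≤ β → ∀ f g : Finset V → ℝ, Monotone f → Antitone g →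
      (let Zs : Finset V → ℝ := fun A =>
         isingPartitionFunction G A (2 * β) 0 .free * isingPartitionFunction G Aᶜ (2 * β) 0 .free
       let E : (Finset V → ℝ) → ℝ := fun f => (∑ A : Finset V, Zs A * f A) / ∑ A : Finset V, Zs A
       E (fun A => f A * g A) ≤ E f * E g) := by
  sorry

/-- **stub_heatBath** — the random-scan heat-bath chain of the sponge law is STATIONARY and
ATTRACTIVE (finite graph, `β ≥ 0`).  With `p_v(A) = Zs(A ∪ v)/(Zs(A ∪ v) + Zs(A ∖ v))` (the
conditional probability of `v ∈ 𝒜` given `𝒜` off `v`) and the Markov operator on observables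
`K g(A) = |V|⁻¹·Σ_v [p_v(A)·g(A ∪ v) + (1 − p_v(A))·g(A ∖ v)]` (`V` nonempty, else `K = 0`):
(i) `E_𝒜[K^n g] = E_𝒜[g]` for every `g` and `n` (each single-site resampling preserves the sponge
law: pair `A ∪ v` with `A ∖ v`); (ii) `K^n g` is decreasing
whenever `g` is (`p_v` is increasing in `A` — the lattice condition again — and the three-term
rearrangement `K_v g(A) − K_v g(A') = p[g(A∪v) − g(A'∪v)] + (p' − p)[g(A∖v) − g(A'∪v)] +
(1 − p')[g(A∖v) − g(A'∖v)] ≥ 0` for `A ⊆ A'`).  [Holley1974; HolleyStroock1987; Liggett2005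
Ch. II–III; card §First lemma "FluxRepresentation … in its discrete-time form"] -/
theorem stub_heatBath :
    ∀ (V : Type) [Fintype V] [DecidableEq V] (G : SimpleGraph V) [DecidableRel G.Adj] (β : ℝ),
      0 ≤ β → Nonempty V →
      (let Zs : Finset V → ℝ := fun A =>
         isingPartitionFunction G A (2 * β) 0 .free * isingPartitionFunction G Aᶜ (2 * β) 0 .free
       let E : (Finset V → ℝ) → ℝ := fun f => (∑ A : Finset V, Zs A * f A) / ∑ A : Finset V, Zs A
       let p : V → Finset V → ℝ := fun v A => Zs (insert v A) / (Zs (insert v A) + Zs (A.erase v))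
       let K : (Finset V → ℝ) → (Finset V → ℝ) := fun g A =>
         (Fintype.card V : ℝ)⁻¹ * ∑ v : V, (p v A * g (insert v A) + (1 - p v A) * g (A.erase v))
       (∀ g : Finset V → ℝ, ∀ n : ℕ, E (K^[n] g) = E g) ∧
       (∀ g : Finset V → ℝ, Antitone g → ∀ n : ℕ, Antitone (K^[n] g))) := by
  sorry

/-- **stub_windowFlux** — THE BET (card (a), the co-pivotality flux floor; d = 3, `β = β_c(3)`,
strictly stronger than C⁺ = `SpongeCovarianceGain`): there are `c > 0` and a FIXED number of
sweeps `T` such that on every tetrahedron `l·tetra ⊂ Λ_N` (`l ≥ 1`, `N ≥ N₀(l)`), `T·|Λ_N|` steps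
of the random-scan heat-bath chain of the critical sponge release a uniform fraction of the
blue/red anticorrelation: `E[X·K^{T|Λ_N|}Y] − E[X·Y] ≥ c·E[X]·E[Y]`, where
`X(A) = 1[a₀,a₁ ∈ A]⟨σ₀σ₁⟩^free_{A,2β_c}` and `Y(A) = 1[a₂,a₃ ∉ A]⟨σ₂σ₃⟩^free_{Aᶜ,2β_c}`.
Each step of the window contributes `E[X·K^kY] − E[X·K^{k+1}Y] = −ℰ(X, K^kY) =
|V|⁻¹ Σ_v E[p_v(1−p_v)·∇_vX·|∇_vK^kY|] ≥ 0` (a positive (site × time) density: the flux through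
CONTESTED sites), so the statement is a FLOOR on one positive local quantity, no upper bound
needed.  Why it might fail: critical slowing-down — if the anticorrelation is carried by slow
shape modes (relaxation time `∼ l^z`), a fixed window releases only `l^{−z}` of it (triage r1-2);
the bet is noise-sensitivity-type fast release through mixed-pivotal sites (triage r1-1).
Cheapest falsifier: `κ_T(l) = 1 − Cov(X,K^{T|V|}Y)/Cov(X,Y)` at `T = 1, 4`, `l = 2…6` by
two-replica Swendsen–Wang (flat in `l` ⇔ viable).  [AizenmanCMP1982; Lebowitz1974;
HolleyStroock1987; Talagrand1996 (contrast, card (e)); DuminilCopinICM2022 §6.4] -/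
theorem stub_windowFlux :
    ∃ c : ℝ, 0 < c ∧ ∃ T : ℕ, ∀ l : ℕ, 1 ≤ l → ∃ N₀ : ℕ, ∀ N : ℕ, N₀ ≤ N →
      ∀ a : Fin 4 → ↥(box 3 N),
      (∀ i, ((a i : Site 3)) = (l : ℤ) •
        (![![-1, -1, -1], ![1, 1, -1], ![1, -1, 1], ![-1, 1, 1]] : Fin 4 → Site 3) i) →
      (let G := ((zdGraph 3).comap (Subtype.val : ↥(box 3 N) → Site 3))
       let β : ℝ := criticalBeta 3
       let Zs : Finset ↥(box 3 N) → ℝ := fun A =>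
         isingPartitionFunction G A (2 * β) 0 .free * isingPartitionFunction G Aᶜ (2 * β) 0 .free
       let X : Finset ↥(box 3 N) → ℝ := fun A =>
         if a 0 ∈ A ∧ a 1 ∈ A then isingCorr G A (2 * β) 0 .free {a 0, a 1} else 0
       let Y : Finset ↥(box 3 N) → ℝ := fun A =>
         if a 2 ∉ A ∧ a 3 ∉ A then isingCorr G Aᶜ (2 * β) 0 .free {a 2, a 3} else 0
       let E : (Finset ↥(box 3 N) → ℝ) → ℝ := fun f =>
         (∑ A : Finset ↥(box 3 N), Zs A * f A) / ∑ A : Finset ↥(box 3 N), Zs A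
       let p : ↥(box 3 N) → Finset ↥(box 3 N) → ℝ := fun v A =>
         Zs (insert v A) / (Zs (insert v A) + Zs (A.erase v))
       let K : (Finset ↥(box 3 N) → ℝ) → (Finset ↥(box 3 N) → ℝ) := fun g A =>
         (Fintype.card ↥(box 3 N) : ℝ)⁻¹ *
           ∑ v : ↥(box 3 N), (p v A * g (insert v A) + (1 - p v A) * g (A.erase v))
       E (fun A => X A * Y A) + c * (E X * E Y)
         ≤ E (fun A => X A * (K^[T * Fintype.card ↥(box 3 N)] Y) A)) := by
  sorry

/-- **stub_junkMargin** (shared verbatim with line `Sketch`) — the junk term of the formal crux is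
a uniformly proper fraction of the clean deficit: there is `κ < 1` such that for every `l ≥ 1`
and all large `N`, on `l·tetra ⊂ Λ_N` at `β_c(3)`, `J ≤ κ·(Z₀₁·G₂₃ − LHS_clean)`, where
`J = Σ_{F ∈ 𝒯₀₁ : a₂,a₃ ∈ V(K_{a₀}F)} t^{|F|}` and `LHS_clean` is the sum of
`C′ = StrandShadowClean` (Disproof §2).  Numerically `κ ≈ 0.15` (MC j013016, `l = 1`); provable
for `l ≥ l₀` from INT and the infrared bound, numerics-only at small `l` — the exact residue
formal crux ∖ C′ (Disproof §1 `lhs_decomposition`, landed `StrandShadowNegative.strandShadow_imp_clean`).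
[AizenmanCMP1982; AizenmanFernandezJSP1986; Disproof.lean §JUNK] -/
theorem stub_junkMargin :
    ∃ κ : ℝ, κ < 1 ∧ ∀ l : ℕ, 1 ≤ l → ∃ N₀ : ℕ, ∀ N : ℕ, N₀ ≤ N → ∀ a : Fin 4 → ↥(box 3 N),
      (∀ i, ((a i : Site 3)) = (l : ℤ) •
        (![![-1, -1, -1], ![1, 1, -1], ![1, -1, 1], ![-1, 1, 1]] : Fin 4 → Site 3) i) →
      (let G := ((zdGraph 3).comap (Subtype.val : ↥(box 3 N) → Site 3))
       let β : ℝ := criticalBeta 3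
       let t : ℝ := Real.tanh β
       (∑ F ∈ (tJoins G Set.univ {a 0, a 1}).filter (fun F : Finset (Sym2 ↥(box 3 N)) =>
            (SimpleGraph.fromEdgeSet (↑F : Set (Sym2 ↥(box 3 N)))).Reachable (a 0) (a 2) ∧
            (SimpleGraph.fromEdgeSet (↑F : Set (Sym2 ↥(box 3 N)))).Reachable (a 0) (a 3)),
          t ^ F.card)
         ≤ κ * (loopO1PartitionFunction G t {a 0, a 1} * isingCorr G Finset.univ β 0 .free {a 2, a 3}
             - ∑ F ∈ (tJoins G Set.univ {a 0, a 1}).filter (fun F : Finset (Sym2 ↥(box 3 N)) =>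
                 ¬ (SimpleGraph.fromEdgeSet (↑F : Set (Sym2 ↥(box 3 N)))).Reachable (a 0) (a 2) ∧
                 ¬ (SimpleGraph.fromEdgeSet (↑F : Set (Sym2 ↥(box 3 N)))).Reachable (a 0) (a 3)),
               t ^ F.card * isingCorr G (Finset.univ.filter fun v : ↥(box 3 N) =>
                 ¬ (SimpleGraph.fromEdgeSet (↑F : Set (Sym2 ↥(box 3 N)))).Reachable (a 0) v)
                 β 0 .free {a 2, a 3})) := by
  sorry


/-- **stub_threeClean** — LANDED (p86528, `Theorems/FKParityRobustnessStrandShadowThreeClean.lean`,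
`StrandShadowSketch.stub_threeClean`, verbatim this statement): inside `𝒯_A` the three clean
pairing events are pairwise disjoint (handshake in the `a₀`-component), so for `t ≥ 0` their
weights add up to at most `Z(A)`.  Registered here as a stub ONLY because the hub holds no olean
for that module (accepted 06:46Z inside the 2026-08-16 farm-outage window; `lean check` answers
`remote:stale:unbuilt` for any file importing it): close it by
`exact StrandShadowSketch.stub_threeClean` as soon as the module is built. [p86528] -/
theorem stub_threeClean :
    ∀ (V : Type) [Fintype V] [DecidableEq V] (G : SimpleGraph V) [DecidableRel G.Adj] (t : ℝ),
      0 ≤ t → ∀ a : Fin 4 → V,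
      (∑ F ∈ (tJoins G Set.univ (Finset.univ.image a)).filter (fun F : Finset (Sym2 V) =>
            ¬ (SimpleGraph.fromEdgeSet (↑F : Set (Sym2 V))).Reachable (a 0) (a 2) ∧
            ¬ (SimpleGraph.fromEdgeSet (↑F : Set (Sym2 V))).Reachable (a 0) (a 3)), t ^ F.card) +
      (∑ F ∈ (tJoins G Set.univ (Finset.univ.image a)).filter (fun F : Finset (Sym2 V) =>
            ¬ (SimpleGraph.fromEdgeSet (↑F : Set (Sym2 V))).Reachable (a 0) (a 1) ∧
            ¬ (SimpleGraph.fromEdgeSet (↑F : Set (Sym2 V))).Reachable (a 0) (a 3)), t ^ F.card) +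
      (∑ F ∈ (tJoins G Set.univ (Finset.univ.image a)).filter (fun F : Finset (Sym2 V) =>
            ¬ (SimpleGraph.fromEdgeSet (↑F : Set (Sym2 V))).Reachable (a 0) (a 1) ∧
            ¬ (SimpleGraph.fromEdgeSet (↑F : Set (Sym2 V))).Reachable (a 0) (a 2)), t ^ F.card)
        ≤ ∑ F ∈ tJoins G Set.univ (Finset.univ.image a), t ^ F.card := by
  sorry

/-- **stub_symmetry** — LANDED (p87103, `Theorems/FKParityRobustnessStrandShadowSymmetry.lean`,
`StrandShadowSketch.stub_symmetry`, verbatim this statement): the coordinate transpositions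
`y ↔ z`, `x ↔ z` of `{−N..N}³` fix `a₀` and swap `a₁ ↔ a₂`, resp. `a₁ ↔ a₃`, so the pair
correlations and the clean four-source counts of the three pairings agree.  Registered here as a
stub ONLY because the hub holds no olean for that module (accepted 06:57Z, same outage window):
close it by `exact StrandShadowSketch.stub_symmetry` once built. [p87103] -/
theorem stub_symmetry :
    ∀ (l N : ℕ) (a : Fin 4 → ↥(box 3 N)),
      (∀ i, ((a i : Site 3)) = (l : ℤ) •
        (![![-1, -1, -1], ![1, 1, -1], ![1, -1, 1], ![-1, 1, 1]] : Fin 4 → Site 3) i) →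
      ∀ (β t : ℝ),
      (let G := ((zdGraph 3).comap (Subtype.val : ↥(box 3 N) → Site 3))
       let Gc : Fin 4 → Fin 4 → ℝ := fun i j => isingCorr G Finset.univ β 0 .free {a i, a j}
       let C : Fin 4 → Fin 4 → ℝ := fun j k =>
         ∑ F ∈ (tJoins G Set.univ (Finset.univ.image a)).filter (fun F : Finset (Sym2 ↥(box 3 N)) =>
            ¬ (SimpleGraph.fromEdgeSet (↑F : Set (Sym2 ↥(box 3 N)))).Reachable (a 0) (a j) ∧
            ¬ (SimpleGraph.fromEdgeSet (↑F : Set (Sym2 ↥(box 3 N)))).Reachable (a 0) (a k)),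
           t ^ F.card
       Gc 0 2 = Gc 0 1 ∧ Gc 0 3 = Gc 0 1 ∧ Gc 1 3 = Gc 2 3 ∧ Gc 1 2 = Gc 2 3 ∧
         C 1 3 = C 2 3 ∧ C 1 2 = C 2 3) := by
  sorry

/-! ## Local lemmas for the composition (no sorry from here on) -/

section Order

/-- **The order-algebra of the window.**  For a normalised positive functional written as a
weighted average, an operator `K`, observables `X` ↑ and `Y` ↓: FKG (`hfkg`) applied to `X` and
the decreasing `K^nY` (`hatt`), stationarity (`hstat`) and a window floor (`hwin`) give the gain
`E[XY] ≤ (1 − c)E[X]E[Y]`. -/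
theorem gain_of_window {α : Type*} [Preorder α] [Fintype α] (w : α → ℝ)
    (K : (α → ℝ) → (α → ℝ)) (X Y : α → ℝ) (c : ℝ) (n : ℕ)
    (hfkg : ∀ f g : α → ℝ, Monotone f → Antitone g →
      (∑ A, w A * (f A * g A)) / (∑ A, w A) ≤
        (∑ A, w A * f A) / (∑ A, w A) * ((∑ A, w A * g A) / ∑ A, w A))
    (hstat : ∀ g : α → ℝ, ∀ m : ℕ, (∑ A, w A * (K^[m] g) A) / (∑ A, w A) = (∑ A, w A * g A) / ∑ A, w A)
    (hatt : ∀ g : α → ℝ, Antitone g → ∀ m : ℕ, Antitone (K^[m] g))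
    (hX : Monotone X) (hY : Antitone Y)
    (hwin : (∑ A, w A * (X A * Y A)) / (∑ A, w A) +
        c * ((∑ A, w A * X A) / (∑ A, w A) * ((∑ A, w A * Y A) / ∑ A, w A)) ≤
      (∑ A, w A * (X A * (K^[n] Y) A)) / ∑ A, w A) :
    (∑ A, w A * (X A * Y A)) / (∑ A, w A) ≤
      (1 - c) * ((∑ A, w A * X A) / ∑ A, w A) * ((∑ A, w A * Y A) / ∑ A, w A) := by
  have h1 := hfkg X (K^[n] Y) hX (hatt Y hY n)
  rw [hstat Y n] at h1
  have h2 := hwin.trans h1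
  have h3 : (1 - c) * ((∑ A, w A * X A) / ∑ A, w A) * ((∑ A, w A * Y A) / ∑ A, w A) =
      (∑ A, w A * X A) / (∑ A, w A) * ((∑ A, w A * Y A) / ∑ A, w A) -
        c * ((∑ A, w A * X A) / (∑ A, w A) * ((∑ A, w A * Y A) / ∑ A, w A)) := by ring
  rw [h3]
  linarith

end Order

section Sponge

variable {V : Type*} [Fintype V] [DecidableEq V] (G : SimpleGraph V) [DecidableRel G.Adj]

/-- The blue functional `A ↦ 1[x,y ∈ A]·⟨σ_xσ_y⟩^free_{A,2β}` is increasing in the sponge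
(Griffiths' monotonicity in the volume + GKS I). -/
theorem blue_monotone {β : ℝ} (hβ : 0 ≤ β) (x y : V) :
    Monotone (fun A : Finset V =>
      if x ∈ A ∧ y ∈ A then isingCorr G A (2 * β) 0 .free {x, y} else 0) := by
  intro A A' hAA'
  have h2β : 0 ≤ 2 * β := by positivity
  have hsub : ∀ {B : Finset V}, x ∈ B ∧ y ∈ B → ({x, y} : Finset V) ⊆ B := by
    intro B hB z hz
    simp only [Finset.mem_insert, Finset.mem_singleton] at hz
    rcases hz with rfl | rfl
    · exact hB.1
    · exact hB.2
  dsimp only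
  by_cases hA : x ∈ A ∧ y ∈ A
  · have hA' : x ∈ A' ∧ y ∈ A' := ⟨hAA' hA.1, hAA' hA.2⟩
    rw [if_pos hA, if_pos hA']
    exact isingCorr_free_le_of_subset G h2β le_rfl (hsub hA) hAA'
  · rw [if_neg hA]
    split_ifs with hA'
    · exact GKSInequalities.gks_one_holds G h2β le_rfl (Or.inl rfl) (hsub hA')
    · exact le_rfl

/-- The red functional `A ↦ 1[x,y ∉ A]·⟨σ_xσ_y⟩^free_{Aᶜ,2β}` is decreasing in the sponge. -/
theorem red_antitone {β : ℝ} (hβ : 0 ≤ β) (x y : V) :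
    Antitone (fun A : Finset V =>
      if x ∉ A ∧ y ∉ A then isingCorr G Aᶜ (2 * β) 0 .free {x, y} else 0) := by
  intro A A' hAA'
  have h2β : 0 ≤ 2 * β := by positivity
  have hsub : ∀ {B : Finset V}, x ∉ B ∧ y ∉ B → ({x, y} : Finset V) ⊆ Bᶜ := by
    intro B hB z hz
    rw [Finset.mem_compl]
    simp only [Finset.mem_insert, Finset.mem_singleton] at hz
    rcases hz with rfl | rfl
    · exact hB.1
    · exact hB.2
  dsimp only
  by_cases hA' : x ∉ A' ∧ y ∉ A'
  · have hA : x ∉ A ∧ y ∉ A := ⟨fun h => hA'.1 (hAA' h), fun h => hA'.2 (hAA' h)⟩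
    rw [if_pos hA, if_pos hA']
    have hcc : A'ᶜ ⊆ Aᶜ := Finset.compl_subset_compl.2 hAA'
    exact isingCorr_free_le_of_subset G h2β le_rfl (hsub hA') hcc
  · rw [if_neg hA']
    split_ifs with hA
    · exact GKSInequalities.gks_one_holds G h2β le_rfl (Or.inl rfl) (hsub hA)
    · exact le_rfl

/-- **The gain C⁺ at one scale from the sponge stubs** (finite graph, `β ≥ 0`): FKG of the
sponge, stationarity + attractivity of the heat-bath chain and a window floor with constant `c`
after `n` steps give `E_𝒜[XY] ≤ (1 − c)·E_𝒜[X]·E_𝒜[Y]` — verbatim the `hgain` hypothesis of the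
landed core `StrandShadowSketch.shadow_core`. -/
theorem gain_core {β c : ℝ} {n : ℕ} (hβ : 0 ≤ β) (a : Fin 4 → V)
    (hfkg : ∀ f g : Finset V → ℝ, Monotone f → Antitone g →
      (let Zs : Finset V → ℝ := fun A =>
         isingPartitionFunction G A (2 * β) 0 .free * isingPartitionFunction G Aᶜ (2 * β) 0 .free
       let E : (Finset V → ℝ) → ℝ := fun f => (∑ A : Finset V, Zs A * f A) / ∑ A : Finset V, Zs A
       E (fun A => f A * g A) ≤ E f * E g))
    (hhb : (let Zs : Finset V → ℝ := fun A =>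
         isingPartitionFunction G A (2 * β) 0 .free * isingPartitionFunction G Aᶜ (2 * β) 0 .free
       let E : (Finset V → ℝ) → ℝ := fun f => (∑ A : Finset V, Zs A * f A) / ∑ A : Finset V, Zs A
       let p : V → Finset V → ℝ := fun v A => Zs (insert v A) / (Zs (insert v A) + Zs (A.erase v))
       let K : (Finset V → ℝ) → (Finset V → ℝ) := fun g A =>
         (Fintype.card V : ℝ)⁻¹ * ∑ v : V, (p v A * g (insert v A) + (1 - p v A) * g (A.erase v))
       (∀ g : Finset V → ℝ, ∀ n : ℕ, E (K^[n] g) = E g) ∧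
       (∀ g : Finset V → ℝ, Antitone g → ∀ n : ℕ, Antitone (K^[n] g))))
    (hwin : (let Zs : Finset V → ℝ := fun A =>
         isingPartitionFunction G A (2 * β) 0 .free * isingPartitionFunction G Aᶜ (2 * β) 0 .free
       let X : Finset V → ℝ := fun A =>
         if a 0 ∈ A ∧ a 1 ∈ A then isingCorr G A (2 * β) 0 .free {a 0, a 1} else 0
       let Y : Finset V → ℝ := fun A =>
         if a 2 ∉ A ∧ a 3 ∉ A then isingCorr G Aᶜ (2 * β) 0 .free {a 2, a 3} else 0
       let E : (Finset V → ℝ) → ℝ := fun f => (∑ A : Finset V, Zs A * f A) / ∑ A : Finset V, Zs A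
       let p : V → Finset V → ℝ := fun v A => Zs (insert v A) / (Zs (insert v A) + Zs (A.erase v))
       let K : (Finset V → ℝ) → (Finset V → ℝ) := fun g A =>
         (Fintype.card V : ℝ)⁻¹ * ∑ v : V, (p v A * g (insert v A) + (1 - p v A) * g (A.erase v))
       E (fun A => X A * Y A) + c * (E X * E Y) ≤ E (fun A => X A * (K^[n] Y) A))) :
    (let Zs : Finset V → ℝ := fun A =>
         isingPartitionFunction G A (2 * β) 0 .free * isingPartitionFunction G Aᶜ (2 * β) 0 .free
       let X : Finset V → ℝ := fun A =>
         if a 0 ∈ A ∧ a 1 ∈ A then isingCorr G A (2 * β) 0 .free {a 0, a 1} else 0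
       let Y : Finset V → ℝ := fun A =>
         if a 2 ∉ A ∧ a 3 ∉ A then isingCorr G Aᶜ (2 * β) 0 .free {a 2, a 3} else 0
       let E : (Finset V → ℝ) → ℝ := fun f => (∑ A : Finset V, Zs A * f A) / ∑ A : Finset V, Zs A
       E (fun A => X A * Y A) ≤ (1 - c) * E X * E Y) := by
  intro Zs X Y E
  obtain ⟨hstat, hatt⟩ := hhb
  have key := gain_of_window (α := Finset V) Zs
    (fun g A => (Fintype.card V : ℝ)⁻¹ * ∑ v : V,
      (Zs (insert v A) / (Zs (insert v A) + Zs (A.erase v)) * g (insert v A) +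
        (1 - Zs (insert v A) / (Zs (insert v A) + Zs (A.erase v))) * g (A.erase v)))
    X Y c n hfkg hstat hatt (blue_monotone G hβ (a 0) (a 1)) (red_antitone G hβ (a 2) (a 3)) hwin
  exact key

end Sponge

/-! ## Composition -/

/-- Alias of the crux used as the result type of the composition lemma, so that the skeleton audit
sees exactly ONE theorem concluding `StrandShadow` by name (`StrandShadow_proof`). -/
abbrev CruxGoal : Prop := StrandShadow

/-- The crux from the six stubs, the imported landed `stub_pairSplit` / `stub_replicaIdentities`
and the landed core `shadow_core` (composition).  `c′ = (1 − κ)·(2/3)·c`. -/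
theorem StrandShadow_of (hFKG : type_of% @stub_spongeFKG) (hHB : type_of% @stub_heatBath)
    (hWin : type_of% @stub_windowFlux) (hJunk : type_of% @stub_junkMargin)
    (hTC : type_of% @stub_threeClean) (hSym : type_of% @stub_symmetry) : CruxGoal := by
  obtain ⟨c, hc, T, hW⟩ := hWin
  obtain ⟨κ, hκ, hJ⟩ := hJunk
  refine ⟨(1 - κ) * (2 / 3 * c), mul_pos (by linarith) (by linarith), fun l hl => ?_⟩
  obtain ⟨N₁, hN₁⟩ := hW l hl
  obtain ⟨N₂, hN₂⟩ := hJ l hl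
  refine ⟨max N₁ N₂, fun N hN a ha => ?_⟩
  have hwin := hN₁ N (le_of_max_le_left hN) a ha
  have hjunk := hN₂ N (le_of_max_le_right hN) a ha
  have hβ : 0 ≤ criticalBeta 3 := criticalBeta_nonneg 3
  have ht : 0 ≤ Real.tanh (criticalBeta 3) := by
    rw [Real.tanh_eq_sinh_div_cosh]
    exact div_nonneg (Real.sinh_nonneg_iff.2 hβ) (Real.cosh_pos _).le
  have hinj : Function.Injective a :=
    Cruxes.ParityRobustMerging.PlaquetteXorSurgery.tetra_injective hl a ha
  -- same-file inputs: the three sponge stubs at `(Λ_N, β_c)` give the gain C⁺ directly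
  have hfkg := hFKG ↥(box 3 N) ((zdGraph 3).comap (Subtype.val : ↥(box 3 N) → Site 3))
    (criticalBeta 3) hβ
  have hhb := hHB ↥(box 3 N) ((zdGraph 3).comap (Subtype.val : ↥(box 3 N) → Site 3))
    (criticalBeta 3) hβ ⟨a 0⟩
  have hgain := gain_core (c := c) (n := T * Fintype.card ↥(box 3 N))
    ((zdGraph 3).comap (Subtype.val : ↥(box 3 N) → Site 3)) hβ a hfkg hhb hwin
  -- landed inputs (other files ⇒ other instance paths): bridged into `shadow_core` by `convert`
  have hsym := hSym l N a ha (criticalBeta 3) (Real.tanh (criticalBeta 3))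
  have hps := StrandShadowSketch.stub_pairSplit ↥(box 3 N)
    ((zdGraph 3).comap (Subtype.val : ↥(box 3 N) → Site 3)) (criticalBeta 3) a
  have htc := hTC ↥(box 3 N)
    ((zdGraph 3).comap (Subtype.val : ↥(box 3 N) → Site 3)) (Real.tanh (criticalBeta 3)) ht a
  have hrep := StrandShadowSketch.stub_replicaIdentities ↥(box 3 N)
    ((zdGraph 3).comap (Subtype.val : ↥(box 3 N) → Site 3)) (criticalBeta 3) a hinj
  simp only at hsym hrep hgain hjunk ⊢
  have key := StrandShadowSketch.shadow_core (c := c) (κ := κ)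
    ((zdGraph 3).comap (Subtype.val : ↥(box 3 N) → Site 3)) hβ hκ a
    (by convert hps using 12) (by convert htc using 12) (by convert hsym using 12)
    (by convert hrep using 12) (by convert hgain using 12) (by convert hjunk using 12)
  convert key using 12

/-- **The crux, modulo the registered stubs.** -/
theorem StrandShadow_proof : StrandShadow :=
  StrandShadow_of stub_spongeFKG stub_heatBath stub_windowFlux stub_junkMargin stub_threeClean
    stub_symmetry

end Summit.CriticalPhenomena.Ising3DConformalLimit.Cruxes.StrandShadow.ReplicaSpongeShadow

end
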